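import Literature.Computability.Complexity.Mod2TseitinGadget
import HarnessLib

/-!
# The Tseitin → `MOD2` gadget (Grigoriev 2001, Lemma 10), Ib: the matching of a pattern

Continuation of `Mod2TseitinGadget.lean` (points `Pt G npad`, windows, free points and the local
matchings `localM`). For a PATTERN `A ⊆ ℕ` (edge labels `e` with Tseitin value `x_e = 1`) we
assemble the matching `M A` of the complete graph on the points: the padding pairs (`padM`), the
CROSS edges `{b_{u,e}, b_{v,e}}`, `e ∈ A` (`crossM`), and the local matchings of all gadgets; and
its covered set `Cov A`. Main facts: `isPMOn_M` — `M A` is a perfect matching of `Cov A`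
(Rothvoß-file vocabulary `IsPMOn`); `inl_mem_Cov_iff` — a gadget point of `v` is uncovered iff
the Tseitin constraint of `v` fails on `A` (evenly many incident labels in `A`) and the point is
not cross-matched; `inr_mem_Cov` — padding points are covered. This is the semantic content of
Buss–Grigoriev–Impagliazzo–Pitassi's reduction as used in Grigoriev 2001, Lemma 10 ("`PTS_k(2)` is
`(4r,4r)`-reducible to `MOD2_{k(1+2r)}`").

## References

* D. Grigoriev, *Linear lower bound on degrees of Positivstellensatz calculus proofs for the
  parity*, Theoret. Comput. Sci. 259 (2001) 613–622, Lemma 10. [Grigoriev2001TCS]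
-/

noncomputable section

open Finset
open Literature.Barriers.PneNP (IsPMOn exists_isPMOn_of_even)

namespace Literature.Computability.Complexity

namespace Mod2Gadget

variable {V : Type*} [Fintype V] [DecidableEq V] {G : LGraph V} {npad : ℕ}

/-- **The number of points**: `|Pt| = Σ_v (1 + 2 |star v|) + 2 npad`.
[cite: Grigoriev2001TCS, Lemma 10 ("MOD2_{k(1+2r)}")] -/
theorem card_pt : Fintype.card (Pt G npad) = (∑ v : V, (1 + 2 * (G.star v).card)) + 2 * npad := by
  rw [Fintype.card_sum, Fintype.card_sigma, Fintype.card_prod, Fintype.card_fin,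
    Fintype.card_bool]
  congr 1
  · refine sum_congr rfl fun v _ => ?_
    rw [Fintype.card_option, Fintype.card_prod, Fintype.card_bool, Fintype.card_coe]
    ring
  · ring

/-- Edges of the local matching join free points of the gadget. [cite: Grigoriev2001TCS, Lemma 10] -/
theorem mem_free_of_mem_localM {v : V} {A : Finset ℕ} {s : Sym2 (Pt G npad)}
    (hs : s ∈ localM G npad v A) {p : Pt G npad} (hp : p ∈ s) : p ∈ free G npad v A := by
  by_cases h : Even (free G npad v A).card
  · exact (isPMOn_localM h).mem_of_mem hs hp
  · rw [localM_eq_empty h] at hs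
    exact absurd hs (notMem_empty _)

/-! ### Cross edges and padding pairs -/

open Classical in
/-- The CROSS matching of a pattern: the edges `{b_{v,e}, b_{u,e}}` for `e ∈ A`.
[cite: Grigoriev2001TCS, Lemma 10] -/
def crossM (G : LGraph V) (npad : ℕ) (A : Finset ℕ) : Finset (Sym2 (Pt G npad)) :=
  univ.filter fun s => ∃ (v : V) (e : ↥(G.star v)), (e : ℕ) ∈ A ∧ s = cedge v e

open Classical in
/-- The cross-matched points: `b_{v,e}` with `e ∈ A`. [cite: Grigoriev2001TCS, Lemma 10] -/
def crossPts (G : LGraph V) (npad : ℕ) (A : Finset ℕ) : Finset (Pt G npad) :=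
  univ.filter fun p => ∃ (v : V) (e : ↥(G.star v)), (e : ℕ) ∈ A ∧ p = bpt v e

/-- Membership in the cross matching. [cite: Grigoriev2001TCS, Lemma 10] -/
theorem mem_crossM {A : Finset ℕ} {s : Sym2 (Pt G npad)} :
    s ∈ crossM G npad A ↔ ∃ (v : V) (e : ↥(G.star v)), (e : ℕ) ∈ A ∧ s = cedge v e := by
  classical
  rw [crossM, mem_filter]
  exact and_iff_right (mem_univ _)

/-- Membership in the cross-matched points. [cite: Grigoriev2001TCS, Lemma 10] -/
theorem mem_crossPts {A : Finset ℕ} {p : Pt G npad} :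
    p ∈ crossPts G npad A ↔ ∃ (v : V) (e : ↥(G.star v)), (e : ℕ) ∈ A ∧ p = bpt v e := by
  classical
  rw [crossPts, mem_filter]
  exact and_iff_right (mem_univ _)

/-- The edges of the cross matching at the point `b_{v,e}` are exactly `cedge v e` (present iff
`e ∈ A`). [cite: Grigoriev2001TCS, Lemma 10] -/
theorem mem_crossM_and_mem_iff {A : Finset ℕ} {v : V} {e : ↥(G.star v)} {s : Sym2 (Pt G npad)} :
    (s ∈ crossM G npad A ∧ (bpt v e : Pt G npad) ∈ s) ↔ ((e : ℕ) ∈ A ∧ s = cedge v e) := by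
  constructor
  · rintro ⟨hs, hp⟩
    obtain ⟨w, f, hfA, rfl⟩ := mem_crossM.1 hs
    unfold cedge at hp
    rcases Sym2.mem_iff.1 hp with h | h
    · obtain ⟨hvw, hef⟩ := bpt_inj h
      refine ⟨by rw [hef]; exact hfA, ?_⟩
      exact (cedge_congr hvw hef).symm
    · obtain ⟨hvw, hef⟩ := bpt_inj h
      refine ⟨by rw [hef]; exact hfA, ?_⟩
      rw [← cedge_other w f]
      exact (cedge_congr hvw hef).symm
  · rintro ⟨heA, rfl⟩
    exact ⟨mem_crossM.2 ⟨v, e, heA, rfl⟩, Sym2.mem_mk_left _ _⟩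

/-- **The cross matching is a perfect matching of the cross-matched points.**
[cite: Grigoriev2001TCS, Lemma 10] -/
theorem isPMOn_crossM (A : Finset ℕ) : IsPMOn (crossPts G npad A) (crossM G npad A) := by
  refine ⟨fun s hs => ?_, fun s hs => ?_, fun p hp => ?_⟩
  · obtain ⟨v, e, heA, rfl⟩ := mem_crossM.1 hs
    rw [mem_sym2_iff]
    intro p hp
    unfold cedge at hp
    rcases Sym2.mem_iff.1 hp with rfl | rfl
    · exact mem_crossPts.2 ⟨v, e, heA, rfl⟩
    · exact mem_crossPts.2 ⟨G.other v e, ⟨e, LGraph.mem_star_other e.2⟩, heA, rfl⟩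
  · obtain ⟨v, e, -, rfl⟩ := mem_crossM.1 hs
    exact not_isDiag_cedge v e
  · obtain ⟨v, e, heA, rfl⟩ := mem_crossPts.1 hp
    rw [card_eq_one]
    refine ⟨cedge v e, ?_⟩
    ext s
    rw [mem_filter, mem_singleton, mem_crossM_and_mem_iff]
    exact ⟨fun h => h.2, fun h => ⟨heA, h⟩⟩

open Classical in
/-- The PADDING matching: the `npad` fixed pairs. [cite: Grigoriev2001TCS, Lemma 10 (isolated pairs reach every congruent size)] -/
def padM (G : LGraph V) (npad : ℕ) : Finset (Sym2 (Pt G npad)) :=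
  univ.filter fun s => ∃ j : Fin npad, s = s(Sum.inr (j, false), Sum.inr (j, true))

open Classical in
/-- The padding points. [cite: Grigoriev2001TCS, Lemma 10] -/
def padPts (G : LGraph V) (npad : ℕ) : Finset (Pt G npad) :=
  univ.filter fun p => ∃ x : Fin npad × Bool, p = Sum.inr x

/-- Membership in the padding matching. [cite: Grigoriev2001TCS, Lemma 10] -/
theorem mem_padM {s : Sym2 (Pt G npad)} :
    s ∈ padM G npad ↔ ∃ j : Fin npad, s = s(Sum.inr (j, false), Sum.inr (j, true)) := by
  classical
  rw [padM, mem_filter]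
  exact and_iff_right (mem_univ _)

/-- Membership in the padding points. [cite: Grigoriev2001TCS, Lemma 10] -/
theorem mem_padPts {p : Pt G npad} : p ∈ padPts G npad ↔ ∃ x : Fin npad × Bool, p = Sum.inr x := by
  classical
  rw [padPts, mem_filter]
  exact and_iff_right (mem_univ _)

/-- **The padding matching is a perfect matching of the padding points.**
[cite: Grigoriev2001TCS, Lemma 10] -/
theorem isPMOn_padM : IsPMOn (padPts G npad) (padM G npad) := by
  refine ⟨fun s hs => ?_, fun s hs => ?_, fun p hp => ?_⟩
  · obtain ⟨j, rfl⟩ := mem_padM.1 hs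
    rw [mem_sym2_iff]
    intro p hp
    rcases Sym2.mem_iff.1 hp with rfl | rfl
    · exact mem_padPts.2 ⟨_, rfl⟩
    · exact mem_padPts.2 ⟨_, rfl⟩
  · obtain ⟨j, rfl⟩ := mem_padM.1 hs
    rw [Sym2.mk_isDiag_iff]
    simp
  · obtain ⟨⟨j, c⟩, rfl⟩ := mem_padPts.1 hp
    rw [card_eq_one]
    refine ⟨s(Sum.inr (j, false), Sum.inr (j, true)), ?_⟩
    ext s
    rw [mem_filter, mem_singleton, mem_padM]
    constructor
    · rintro ⟨⟨j', rfl⟩, hmem⟩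
      rcases Sym2.mem_iff.1 hmem with h | h
      · simp only [Sum.inr.injEq, Prod.mk.injEq] at h
        rw [h.1]
      · simp only [Sum.inr.injEq, Prod.mk.injEq] at h
        rw [h.1]
    · rintro rfl
      refine ⟨⟨j, rfl⟩, ?_⟩
      cases c
      · exact Sym2.mem_mk_left _ _
      · exact Sym2.mem_mk_right _ _

/-! ### The matching of a pattern and its covered set -/

/-- **The matching `M A` of the pattern `A`**: padding pairs, cross edges of the labels in `A`,
and the local matchings of all gadgets. [cite: Grigoriev2001TCS, Lemma 10] -/
def M (G : LGraph V) (npad : ℕ) (A : Finset ℕ) : Finset (Sym2 (Pt G npad)) :=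
  padM G npad ∪ crossM G npad A ∪ univ.biUnion fun v => localM G npad v A

/-- The set of free points of gadgets whose Tseitin constraint holds (the locally matched
points). [cite: Grigoriev2001TCS, Lemma 10] -/
def locPts (G : LGraph V) (npad : ℕ) (A : Finset ℕ) : Finset (Pt G npad) :=
  univ.biUnion fun v => if Even (free G npad v A).card then free G npad v A else ∅

/-- **The covered set `Cov A`**: padding points, cross-matched points, and the free points of
the gadgets whose constraint holds. [cite: Grigoriev2001TCS, Lemma 10] -/
def Cov (G : LGraph V) (npad : ℕ) (A : Finset ℕ) : Finset (Pt G npad) :=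
  padPts G npad ∪ crossPts G npad A ∪ locPts G npad A

omit [Fintype V] in
/-- Perfect matchings of pairwise disjoint blocks combine (finite union).
[cite: Grigoriev2001TCS, Lemma 10] -/
theorem isPMOn_biUnion {ι : Type*} [DecidableEq ι] (s : Finset ι) (S : ι → Finset (Pt G npad))
    (Mt : ι → Finset (Sym2 (Pt G npad))) (h : ∀ i ∈ s, IsPMOn (S i) (Mt i))
    (hd : ∀ i ∈ s, ∀ j ∈ s, i ≠ j → Disjoint (S i) (S j)) :
    IsPMOn (s.biUnion S) (s.biUnion Mt) := by
  induction s using Finset.induction_on with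
  | empty => rw [biUnion_empty, biUnion_empty]; exact IsPMOn.empty
  | insert a s ha ih =>
    rw [biUnion_insert, biUnion_insert]
    refine (h a (mem_insert_self a s)).union
      (ih (fun i hi => h i (mem_insert_of_mem hi))
        (fun i hi j hj hij => hd i (mem_insert_of_mem hi) j (mem_insert_of_mem hj) hij)) ?_
    rw [disjoint_biUnion_right]
    intro i hi
    exact hd a (mem_insert_self a s) i (mem_insert_of_mem hi) (fun h => ha (h ▸ hi))

/-- The local matchings together form a perfect matching of the locally matched points.
[cite: Grigoriev2001TCS, Lemma 10] -/
theorem isPMOn_localM_biUnion (A : Finset ℕ) :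
    IsPMOn (locPts G npad A) (univ.biUnion fun v => localM G npad v A) := by
  refine isPMOn_biUnion univ _ _ (fun v _ => ?_) (fun v _ w _ hvw => ?_)
  · by_cases h : Even (free G npad v A).card
    · rw [if_pos h]; exact isPMOn_localM h
    · rw [if_neg h, localM_eq_empty h]; exact IsPMOn.empty
  · rw [disjoint_left]
    intro p hp hq
    have hp' : p ∈ free G npad v A := by
      by_cases h : Even (free G npad v A).card
      · rwa [if_pos h] at hp
      · rw [if_neg h] at hp; exact absurd hp (notMem_empty _)
    have hq' : p ∈ free G npad w A := by
      by_cases h : Even (free G npad w A).card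
      · rwa [if_pos h] at hq
      · rw [if_neg h] at hq; exact absurd hq (notMem_empty _)
    rcases p with ⟨u, o⟩ | x
    · exact hvw ((inl_mem_free_iff.1 hp').1.symm.trans (inl_mem_free_iff.1 hq').1)
    · exact inr_not_mem_free hp'

/-- Membership in the locally matched points. [cite: Grigoriev2001TCS, Lemma 10] -/
theorem mem_locPts {A : Finset ℕ} {p : Pt G npad} :
    p ∈ locPts G npad A ↔ ∃ v, Even (free G npad v A).card ∧ p ∈ free G npad v A := by
  rw [locPts, mem_biUnion]
  constructor
  · rintro ⟨v, -, hp⟩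
    by_cases h : Even (free G npad v A).card
    · rw [if_pos h] at hp; exact ⟨v, h, hp⟩
    · rw [if_neg h] at hp; exact absurd hp (notMem_empty _)
  · rintro ⟨v, h, hp⟩
    exact ⟨v, mem_univ _, by rw [if_pos h]; exact hp⟩

/-- **`M A` is a perfect matching of `Cov A`.** [cite: Grigoriev2001TCS, Lemma 10] -/
theorem isPMOn_M (A : Finset ℕ) : IsPMOn (Cov G npad A) (M G npad A) := by
  refine (isPMOn_padM.union (isPMOn_crossM A) ?_).union (isPMOn_localM_biUnion A) ?_
  · rw [disjoint_left]
    intro p hp hq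
    obtain ⟨x, rfl⟩ := mem_padPts.1 hp
    obtain ⟨v, e, -, h⟩ := mem_crossPts.1 hq
    cases h
  · rw [disjoint_left]
    intro p hp hq
    obtain ⟨v, -, hpv⟩ := mem_locPts.1 hq
    rcases mem_union.1 hp with hp | hp
    · obtain ⟨x, rfl⟩ := mem_padPts.1 hp
      exact inr_not_mem_free hpv
    · obtain ⟨w, e, heA, rfl⟩ := mem_crossPts.1 hp
      obtain ⟨-, h⟩ := inl_mem_free_iff.1 hpv
      exact h e rfl heA

/-- Edges of `M A` are not loops. [cite: Grigoriev2001TCS, Lemma 10] -/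
theorem not_isDiag_of_mem_M {A : Finset ℕ} {s : Sym2 (Pt G npad)} (hs : s ∈ M G npad A) :
    ¬ s.IsDiag :=
  (isPMOn_M A).not_isDiag hs

/-- **Which points are covered.** A point of the gadget of `v` is covered by `M A` unless the
Tseitin constraint of `v` fails on `A` (evenly many incident labels in `A`) and the point is not
cross-matched; padding points are always covered. [cite: Grigoriev2001TCS, Lemma 10] -/
theorem inl_mem_Cov_iff {A : Finset ℕ} {v : V} {o : Option (↥(G.star v) × Bool)} :
    (Sum.inl ⟨v, o⟩ : Pt G npad) ∈ Cov G npad A ↔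
      ¬ (Even (A ∩ G.star v).card ∧ ∀ e : ↥(G.star v), o = some (e, true) → (e : ℕ) ∉ A) := by
  rw [Cov, mem_union, mem_union, mem_padPts, mem_crossPts, mem_locPts]
  constructor
  · rintro ((⟨x, hx⟩ | ⟨w, e, heA, hpe⟩) | ⟨w, hev, hfree⟩) ⟨hevA, hnot⟩
    · cases hx
    · have hwv : v = w := fst_eq_of_inl_eq hpe
      subst hwv
      exact hnot e (inl_eq_inl_iff.1 hpe) heA
    · obtain ⟨rfl, -⟩ := inl_mem_free_iff.1 hfree
      rw [even_card_free_iff] at hev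
      exact (Nat.not_even_iff_odd.2 hev) hevA
  · intro h
    by_cases hc : ∀ e : ↥(G.star v), o = some (e, true) → (e : ℕ) ∉ A
    · have hodd : Odd (A ∩ G.star v).card := by
        rw [← Nat.not_even_iff_odd]
        exact fun hev => h ⟨hev, hc⟩
      exact Or.inr ⟨v, (even_card_free_iff v A).2 hodd, inl_mem_free_iff.2 ⟨rfl, hc⟩⟩
    · push Not at hc
      obtain ⟨e, rfl, heA⟩ := hc
      exact Or.inl (Or.inr ⟨v, e, heA, rfl⟩)

/-- Padding points are covered. [cite: Grigoriev2001TCS, Lemma 10] -/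
theorem inr_mem_Cov (A : Finset ℕ) (x : Fin npad × Bool) : (Sum.inr x : Pt G npad) ∈ Cov G npad A :=
  mem_union_left _ (mem_union_left _ (mem_padPts.2 ⟨x, rfl⟩))

end Mod2Gadget

end Literature.Computability.Complexity
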